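/- Copyright: the b2b-balaban cell (near-miss cell 7), T⁴-continuum fan-out; row NE7b ROUND-2 swarm, seat
t4-ne7b-formalise-leaf-02 (gen 9) (row S12 «ASSEMBLY», owner sub-row S12i «APEX∕HEADLINE OVER END v3», file 3 of 3;
ruling R-OWNER-23-9, journal l.15621).  Released under the licence of the surrounding project. -/
import Summits.QuantumFields.BalabanUV.T4Continuum.Support.HistoryRealiseCellsRunApexT3b
import Summits.QuantumFields.BalabanUV.T4Continuum.Support.HistoryConstantsSlackT3b

/-!
# Realised histories: THE APEX INPUT AND THE HEADLINE FROM THE COUNT ROAD OVER THE END OF RECORD v3′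

Summits-side support leaf of the T⁴-continuum cell (rung (B)+1 on a FINITE torus only; NOT infinite volume, NOT the
mass gap, NOT the Clay statement; NOT a proof of the spine estimate NE7b).  Row S12 ∕ node A12-I of the claim table
`t4/b2b-balaban-t4-ne7b-p1/LEAVES-NE7b.md`, owner sub-row S12i «APEX∕HEADLINE OVER END v3» (R-OWNER-23-9), file 3: the
twins of the owner's `HistoryRealiseCellsRunApex.hybridNE7Under_of_countRoad` (p219284) ∕
`HistoryRealiseCellsRunHeadline` (p219461, v1.1 p219850) with the END swapped — END OF RECORD v2 ↦ END OF RECORD v3′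
(`HistoryRealiseCellsRunMultEndD.hybridNE7_of_realisedDomainsRun_printedT3bD`, p222385; pinned form file 1 p222798;
witness shape `HistoryRealiseCellsRunApexT3b.CountRoadWitnessT3b`, file 2).

WHAT.  **`hybridNE7Under_of_countRoadT3b_fsc`**: `T4ApexHybrid.HybridNE7Under D (BetaPertHyp D.βfun)` — the apex
lineage's input for ALL FOUR T⁴ TARGETS — from the datum's sign conventions, END v3′'s constants-only side conditions
(displayed in front of the prefix: `ThresholdOK`, `0 < μ`, κ₁∕E₀ largeness, `1 ≤ A₀`, `0 < β₀`, `F.L·β₀ ≤ 1`, `13 ≤ n₁`,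
`0 < n`, the class-linear slack `C.a + θ ≤ ½γ₀A₁²` with `θ` above row S6g′'s instance constant (verbatim), `0 < E₂`,
`0 ≤ E₃`, stride ∕ decay `sS θc` + three arithmetic side conditions — symbolic, c2; NO `Dominates`) and ONE displayed
hypothesis UNDER THE PREFIX `T4ContinuumYM4Torus.ForSmallCouplings`: «for all SMALL-coupling tuned runs `g₀` and all loop
strings `os`, a `CountRoadWitnessT3b`»; its antecedents `(B) = B16.EndStatementBPrinted D.C` and `BetaPertHyp D.βfun` are
consumed BY NAME by the pinned END v3′ for the thresholds `γ₁`, `g₁`, merged with the hypothesis' thresholds by `min` (as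
`ForSmallCouplings.and`).  **`hybridNE7Under_of_countRoadT3b`**: the every-`γ, g > 0` form as a corollary (thresholds
`1, 1`).  **`limit_exists_of_countRoadT3b_fsc`** ∕ **`limit_unique_of_countRoadT3b_fsc`**: existence AND uniqueness of the
continuum limit of every joint expectation of unit-scale averaged loop variables for data with measurable averaging maps
(`T4ApexHybrid.limit_exists∕unique_of_hybridNE7Under`).  **`targets_of_countRoadT3b_fsc`** (the four T⁴ targets —
existence, uniqueness of the limit points, reflection positivity on the positive-time class, torus covariance — for
(0.4)-block-averaged data on `SU(N)` with a measurable small-loop average, `T4ApexHybrid.targets_of_hybridNE7Under`) and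
**`continuumYM4Torus_of_countRoadT3b_fsc`** — THE HEADLINE PREDICATE `T4ContinuumYM4Torus.ContinuumYM4Torus D` from the two
pins `hB : B16.EndStatementBPrinted D.C`, `hβ : BetaPertHyp D.βfun`, the displayed witness hypothesis and the side conditions
(`T4ContinuumYM4Torus.continuumYM4Torus_of_targets`).

THE LOCATED DEMAND, DISPLAYED (finding F-leaf08g7-1, ruling R-OWNER-23-10; the owner's instruction (2)(d) for this
row).  END v3′ AS HOMED charges the class-linear placement entropy to the O(1) slack: its constants-side antecedents
`ThresholdOK`, `hslack : C.a + θ ≤ ½·O.γ₀·O.A₁²`, `hsS`, `hθc0`, `hθc1`, `hθJ : ΘJ(d,sS,θc) + 8·2^d·log(2d+1) ≤ θ` — displayed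
VERBATIM in front of the prefix of every theorem below — force **`8·8710^d < ½·O.γ₀·O.A₁²`** (`≈ 4.6·10¹⁶ <` at `d = 4`),
which NO realistic O(1) printed constants meet: on such constants every theorem of this file is VACUOUSLY TRUE.  This is
made kernel-explicit here BY NAME from leaf-08 gen 7's census `HistoryConstantsSlackT3b.half_gamma_A1_sq_gt_of_END3`
(p223209): **`demand_of_countRoadT3b_consts`**.  The repair is row S12j (END v3.1 «threshold-paid multiplicity»: the
entropy charged to the profile at the infrared threshold, the demand moved into the coupling window where thresholds are
free); a v1.1 of this chain over v3.1 follows when it lands.  Numbers, not adjectives: until then the headline below is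
an implication whose constants-side antecedent is empty for O(1) constants.

HONEST READING (verbatim for headlines; c4).  This is the cell's honest dependency chain made kernel-explicit THROUGH ROW
NE7b's END OF RECORD v3′, not a discharge of anything: `ContinuumYM4Torus D ⇐ (B) ∧ BetaPertHyp ∧ [∀ small-coupling tuned
run ∀ string: CountRoadWitnessT3b]`, and the witness DISPLAYS — as hypothesis shapes, none in print, none a theorem of the
tree — H3 (the terms of Bałaban's expansion read as realised pedigrees with domains, live components dated ≤ cutoff,
`DisjointJoins` ∕ `BoxedBirths`, realised costs, the price sentences in print's currency with the displayed discount
`exp(−Ξ)`, the numerator readings over the physical member families), the E1∕E2 representation, the (γ) floors ∕ site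
budgets ∕ envelopes of the (B) side, NE7c's `ShellWeightBound`, NE7's `ReindexedBudget` (carrying node U4′'s sizes and the
recent-scale rates, hence the content of NE1′–NE5, NE9) and four summable rates.  What v3′ changes against the owner's v2
headline (p219461 ∕ p219850): the slot MULTIPLICITY of the count is no longer displayed (counted in the kernel by THE LAST
JUNCTION, p222172 ∕ p222385); the price is the slack road's (`hslack` with `θ` above the instance constant displayed among
the constants, no `Dominates`) — and, AS HOMED, that price is the located demand `8·8710^d < ½γ₀A₁²` above (vacuous for
O(1) constants; repair S12j in flight).  Spine count 0∕9 UNCHANGED; NE7b NOT proved.  [folklore] composition by name; no `def`, no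
`[cite:]` tag, nothing printed asserted.  HONEST DEPENDENCY (cell): continuum YM on T⁴ ⇐ BetaPertH ∧ nine spine estimates
(0/9 proved); BetaPertH ⇐ (D1) ∧ (D4) ∧ CAP+tail; G-an2-4 gates asym, D1 and NE2/3/4.  This file changes none of it. -/

open Literature.MathematicalPhysics.QuantumFieldTheory.Balaban1983to89
open T4Continuum T4PrintedShapeBanking T4CanonicalMenus
open Summit.QuantumFields.BalabanUV.T4Continuum.CountThresholdUniform
open Summit.QuantumFields.BalabanUV.T4Continuum.HistoryConstants
open Summit.QuantumFields.BalabanUV.T4Continuum.HistoryZoneEvolve (cth)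
open Summit.QuantumFields.BalabanUV.T4Continuum.HistoryRealiseCellsRunPinnedT3b
open Summit.QuantumFields.BalabanUV.T4Continuum.HistoryRealiseCellsRunApexT3b

namespace Summit.QuantumFields.BalabanUV.T4Continuum.HistoryRealiseCellsRunHeadlineT3b

noncomputable section

section Under

variable {F : T4Family} {G : Type*} [GaugeGroup G] [MeasurableSpace G] [HaarData G] [RegularGaugeGroup G]

/-- **THE LOCATED DEMAND OF THE CONSTANTS-SIDE ANTECEDENT, DISPLAYED (F-leaf08g7-1, R-OWNER-23-10 (2)(d)).**  The
constants-side antecedents shared by every theorem of this file (END v3′'s, verbatim) force `8·8710^d < ½·O.γ₀·O.A₁²` —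
BY NAME from leaf-08 gen 7's census `HistoryConstantsSlackT3b.half_gamma_A1_sq_gt_of_END3` at `L := F.L` (the binders
`ThresholdOK`, `hslack`, `hsS`, `hθc0`, `hθc1`, `hθJ` below are token-identical to the theorems').  VACUOUS for O(1)
printed constants; the repair (row S12j, END v3.1) moves the demand into the coupling window. [folklore] -/
theorem demand_of_countRoadT3b_consts {C : T4PrintedShapeBanking.Consts} {O : PrintedO1s} {rr : ℕ} {β₀ : ℝ}
    (h : ThresholdOK C F.L rr β₀) {θ : ℝ} (hslack : C.a + θ ≤ O.γ₀ * O.A₁ ^ 2 / 2) {d sS : ℕ} (hsS : 1 ≤ sS) {θc : ℝ}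
    (hθc0 : 0 ≤ θc) (hθc1 : θc < 1)
    (hθJ : (2 +
            ((2 * (((2 * cth 32 1 sS + 1) ^ d : ℕ) : ℝ) * ((((2 * 32 + 1) ^ d : ℕ) : ℝ) * (4 * 2 ^ d)) +
                  4 * ((((2 * cth 32 1 sS + 1) ^ d : ℕ) : ℝ) * (5 : ℝ) ^ d)) / (1 - θc) +
              2 * (2 * ((((2 * cth 32 1 sS + 1) ^ d : ℕ) : ℝ) * (5 : ℝ) ^ d))) +
            (2 * ((0 + 2 * Real.log (2 * d + 1)) + (2 * (d : ℝ) + 2 * Real.log (2 * d + 1)) *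
                  (((max 1 (2 * 32 + 2) : ℕ) : ℝ) * (2 * ((((2 * cth 32 1 sS + 1) ^ d : ℕ) : ℝ) * (5 : ℝ) ^ d)))) +
              (2 * (d : ℝ) + 2 * Real.log (2 * d + 1)) * 1 *
                (((max 1 (2 * 32 + 2) : ℕ) : ℝ) *
                    ((2 * (((2 * cth 32 1 sS + 1) ^ d : ℕ) : ℝ) * ((((2 * 32 + 1) ^ d : ℕ) : ℝ) * (4 * 2 ^ d)) +
                        4 * ((((2 * cth 32 1 sS + 1) ^ d : ℕ) : ℝ) * (5 : ℝ) ^ d)) / (1 - θc)) +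
                  4 * 2 ^ d)) +
            10) + 8 * 2 ^ d * Real.log (2 * d + 1) ≤ θ) :
    (8 : ℝ) * 8710 ^ d < O.γ₀ * O.A₁ ^ 2 / 2 :=
  HistoryConstantsSlackT3b.half_gamma_A1_sq_gt_of_END3 h hslack hθc0 hθc1 hsS hθJ

/-- **ROW NE7b AT THE APEX OVER END v3′: `HybridNE7Under D (BetaPertHyp D.βfun)` FROM THE PREFIXED WITNESS HYPOTHESIS.**
For data with measurable averaging maps, the datum's sign conventions and END v3′'s constants-only side conditions: if
`ForSmallCouplings D (g₀ ↦ ∀ os, a CountRoadWitnessT3b)` (H3 + representation + (B)-side data + NE7c + NE7 + rates —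
DISPLAYED, none in print, none a theorem of the tree), then the apex input holds; thresholds `min γ₁ γ₂`, `min g₁ g₂` of
the pinned END v3′ (`hybridNE7_of_realisedDomainsRun_pinnedT3bD`, consuming `(B)` and `BetaPertHyp` BY NAME) and of the
hypothesis.  Honest reading: the four T⁴ targets ⇐ (B) ∧ BetaPertHyp ∧ [∀ small-coupling tuned run ∀ string, a count-road
witness over END v3′].  NE7b NOT proved. [folklore] -/
theorem hybridNE7Under_of_countRoadT3b_fsc (D : FiniteEpsData F G) (hM : D.AvgMeasurable)
    (hsign : B16.SignConventions D.C)
    {C : T4PrintedShapeBanking.Consts} {O : PrintedO1s}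
    {rr : ℕ} {β₀ : ℝ} (h : ThresholdOK C F.L rr β₀) (hμ : 0 < C.μ) (d n : ℕ)
    (hκ₁ : (d : ℝ) * Real.log F.L + 2 * Real.log 2 ≤ C.κ₁) (hE₀ : Real.log (2 + birthMass C) ≤ C.E₀)
    (hA₀ : 1 ≤ C.A₀) (hβ₀ : 0 < β₀) (hLβ : (F.L : ℝ) * β₀ ≤ 1) (hn₁ : 13 ≤ C.n₁) (hn : 0 < n)
    {θ : ℝ} (hθ : 0 ≤ θ) (hslack : C.a + θ ≤ O.γ₀ * O.A₁ ^ 2 / 2)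
    (hE₂ : 0 < C.E₂) (hE₃ : 0 ≤ C.E₃) {sS : ℕ} (hsS : 1 ≤ sS)
    (hsmall : (((2 * cth 32 1 sS + 1) ^ d : ℕ) : ℝ) * (5 : ℝ) ^ d * ((max 1 (2 * 32 + 2) : ℕ) : ℝ) ≤
      (F.L : ℝ) ^ (sS / 2) / 2)
    {θc : ℝ} (hθc0 : 0 ≤ θc) (hθc1 : θc < 1) (hθcs : 1 / 2 ≤ θc ^ sS)
    (hθJ : (2 +
            ((2 * (((2 * cth 32 1 sS + 1) ^ d : ℕ) : ℝ) * ((((2 * 32 + 1) ^ d : ℕ) : ℝ) * (4 * 2 ^ d)) +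
                  4 * ((((2 * cth 32 1 sS + 1) ^ d : ℕ) : ℝ) * (5 : ℝ) ^ d)) / (1 - θc) +
              2 * (2 * ((((2 * cth 32 1 sS + 1) ^ d : ℕ) : ℝ) * (5 : ℝ) ^ d))) +
            (2 * ((0 + 2 * Real.log (2 * d + 1)) + (2 * (d : ℝ) + 2 * Real.log (2 * d + 1)) *
                  (((max 1 (2 * 32 + 2) : ℕ) : ℝ) * (2 * ((((2 * cth 32 1 sS + 1) ^ d : ℕ) : ℝ) * (5 : ℝ) ^ d)))) +
              (2 * (d : ℝ) + 2 * Real.log (2 * d + 1)) * 1 *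
                (((max 1 (2 * 32 + 2) : ℕ) : ℝ) *
                    ((2 * (((2 * cth 32 1 sS + 1) ^ d : ℕ) : ℝ) * ((((2 * 32 + 1) ^ d : ℕ) : ℝ) * (4 * 2 ^ d)) +
                        4 * ((((2 * cth 32 1 sS + 1) ^ d : ℕ) : ℝ) * (5 : ℝ) ^ d)) / (1 - θc)) +
                  4 * 2 ^ d)) +
            10) + 8 * 2 ^ d * Real.log (2 * d + 1) ≤ θ)
    (hData : T4ContinuumYM4Torus.ForSmallCouplings D fun g₀ => ∀ os : List (ULoop F),
        ∃ (ι α π : Type) (_ : DecidableEq ι) (_ : DecidableEq α) (_ : DecidableEq π),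
          Nonempty (CountRoadWitnessT3b D C O rr d n hn g₀ os ι α π)) :
    T4ApexHybrid.HybridNE7Under D (BetaPertHyp D.βfun) := by
  intro hB hβ
  obtain ⟨γ₁, hγ₁, H⟩ := hybridNE7_of_realisedDomainsRun_pinnedT3bD D hB hβ hsign h hμ d n hκ₁ hE₀ hA₀ hβ₀ hLβ hn₁ hn
    hθ hslack hE₂ hE₃ hsS hsmall hθc0 hθc1 hθcs hθJ
  obtain ⟨γ₂, hγ₂, H₂⟩ := hData
  refine ⟨min γ₁ γ₂, lt_min hγ₁ hγ₂, fun γ hγ hγle => ?_⟩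
  obtain ⟨g₁, hg₁, Hg⟩ := H γ hγ (hγle.trans (min_le_left _ _))
  obtain ⟨g₂, hg₂, Hg₂⟩ := H₂ γ hγ (hγle.trans (min_le_right _ _))
  refine ⟨min g₁ g₂, lt_min hg₁ hg₂, fun g hg hgle g₀ ht os => ?_⟩
  obtain ⟨Em, -, HE⟩ := Hg g hg (hgle.trans (min_le_left _ _))
  obtain ⟨ι, α, π, _, _, _, ⟨X⟩⟩ := Hg₂ g hg (hgle.trans (min_le_right _ _)) g₀ ht os
  have hm : ∀ K o, Measurable ((D.scheme g₀).obs K o) := fun K o => D.measurable_avgObs hM K o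
  have h1 : ∀ K o U, |(D.scheme g₀).obs K o U| ≤ 1 := fun K o U => D.abs_avgObs_le_one K o U
  obtain ⟨K₁, K₂, hK₁, hH⟩ := HE g₀ ht X.l₀ X.vol X.K₀ X.T X.A X.A' X.shA X.shB X.dead X.dead' X.nup X.mup X.Nup
    X.Cc X.Rr X.CcRec X.RrRec X.ν X.u X.s₂ X.q₀ X.r X.s X.Wsh (fun K => T4GenFunBounds.prodObs (D.scheme g₀) K os) 1
    (fun K => T4GenFunBounds.measurable_prodObs (D.scheme g₀) hm K os)
    (fun K U => T4GenFunBounds.abs_prodObs_le_one (D.scheme g₀) h1 K os U)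
    (fun K t ht hK => (X.reprA K t ht hK).le) (fun K t ht hK => (X.reprB K t ht hK).le) X.c₀ X.n₁ X.c₀_pos X.floor
    X.floor' X.sites X.sites' X.Nup_nonneg X.nup_bd X.mup_bd X.R X.isRj X.one_le_R X.ped X.cellP X.liveC X.Zd X.realised
    X.step_le X.disjointJoins X.boxedBirths X.κ X.κ' X.cost_le X.cost_le' X.FcM X.RfM X.FcM' X.RfM' X.priceM X.priceM'
    X.upM X.deadM_nonneg X.resumM X.FM_nonneg X.upM' X.deadM'_nonneg X.resumM' X.FM'_nonneg X.shell X.budget X.sum_r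
    X.sum_u X.sum_s X.sum_s₂
  exact ⟨X.l₀, X.vol, K₁ + K₂, X.l₀_pos, X.vol_pos, stringHybridNE7_of_hybridNE7T3b D X hK₁ hH⟩

/-- **The every-`γ, g > 0` form** (a witness for EVERY positive-coupling tuned run and every string; thresholds `1, 1` on
the hypothesis' side): corollary of `hybridNE7Under_of_countRoadT3b_fsc`.  CONDITIONAL; NE7b NOT proved. [folklore] -/
theorem hybridNE7Under_of_countRoadT3b (D : FiniteEpsData F G) (hM : D.AvgMeasurable)
    (hsign : B16.SignConventions D.C)
    {C : T4PrintedShapeBanking.Consts} {O : PrintedO1s}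
    {rr : ℕ} {β₀ : ℝ} (h : ThresholdOK C F.L rr β₀) (hμ : 0 < C.μ) (d n : ℕ)
    (hκ₁ : (d : ℝ) * Real.log F.L + 2 * Real.log 2 ≤ C.κ₁) (hE₀ : Real.log (2 + birthMass C) ≤ C.E₀)
    (hA₀ : 1 ≤ C.A₀) (hβ₀ : 0 < β₀) (hLβ : (F.L : ℝ) * β₀ ≤ 1) (hn₁ : 13 ≤ C.n₁) (hn : 0 < n)
    {θ : ℝ} (hθ : 0 ≤ θ) (hslack : C.a + θ ≤ O.γ₀ * O.A₁ ^ 2 / 2)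
    (hE₂ : 0 < C.E₂) (hE₃ : 0 ≤ C.E₃) {sS : ℕ} (hsS : 1 ≤ sS)
    (hsmall : (((2 * cth 32 1 sS + 1) ^ d : ℕ) : ℝ) * (5 : ℝ) ^ d * ((max 1 (2 * 32 + 2) : ℕ) : ℝ) ≤
      (F.L : ℝ) ^ (sS / 2) / 2)
    {θc : ℝ} (hθc0 : 0 ≤ θc) (hθc1 : θc < 1) (hθcs : 1 / 2 ≤ θc ^ sS)
    (hθJ : (2 +
            ((2 * (((2 * cth 32 1 sS + 1) ^ d : ℕ) : ℝ) * ((((2 * 32 + 1) ^ d : ℕ) : ℝ) * (4 * 2 ^ d)) +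
                  4 * ((((2 * cth 32 1 sS + 1) ^ d : ℕ) : ℝ) * (5 : ℝ) ^ d)) / (1 - θc) +
              2 * (2 * ((((2 * cth 32 1 sS + 1) ^ d : ℕ) : ℝ) * (5 : ℝ) ^ d))) +
            (2 * ((0 + 2 * Real.log (2 * d + 1)) + (2 * (d : ℝ) + 2 * Real.log (2 * d + 1)) *
                  (((max 1 (2 * 32 + 2) : ℕ) : ℝ) * (2 * ((((2 * cth 32 1 sS + 1) ^ d : ℕ) : ℝ) * (5 : ℝ) ^ d)))) +
              (2 * (d : ℝ) + 2 * Real.log (2 * d + 1)) * 1 *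
                (((max 1 (2 * 32 + 2) : ℕ) : ℝ) *
                    ((2 * (((2 * cth 32 1 sS + 1) ^ d : ℕ) : ℝ) * ((((2 * 32 + 1) ^ d : ℕ) : ℝ) * (4 * 2 ^ d)) +
                        4 * ((((2 * cth 32 1 sS + 1) ^ d : ℕ) : ℝ) * (5 : ℝ) ^ d)) / (1 - θc)) +
                  4 * 2 ^ d)) +
            10) + 8 * 2 ^ d * Real.log (2 * d + 1) ≤ θ)
    (hData : ∀ (γ g : ℝ) (g₀ : ℕ → ℝ), 0 < γ → 0 < g → D.Tuned γ g g₀ →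
      ∀ os : List (ULoop F), ∃ (ι α π : Type) (_ : DecidableEq ι) (_ : DecidableEq α) (_ : DecidableEq π),
        Nonempty (CountRoadWitnessT3b D C O rr d n hn g₀ os ι α π)) :
    T4ApexHybrid.HybridNE7Under D (BetaPertHyp D.βfun) :=
  hybridNE7Under_of_countRoadT3b_fsc D hM hsign h hμ d n hκ₁ hE₀ hA₀ hβ₀ hLβ hn₁ hn hθ hslack hE₂ hE₃ hsS hsmall hθc0 hθc1 hθcs hθJ
    ⟨1, one_pos, fun γ hγ _ => ⟨1, one_pos, fun g hg _ g₀ ht => hData γ g g₀ hγ hg ht⟩⟩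

/-- **COROLLARY: EXISTENCE** of the continuum limit of every joint expectation of unit-scale averaged loop variables along
the full sequence of spacings, under the prefix (`D.ym4_torus_continuum_limit_exists`), GIVEN the prefixed witnesses over
END v3′ — by `T4ApexHybrid.limit_exists_of_hybridNE7Under`.  CONDITIONAL; NE7b NOT proved. [folklore] -/
theorem limit_exists_of_countRoadT3b_fsc (D : FiniteEpsData F G) (hM : D.AvgMeasurable)
    (hsign : B16.SignConventions D.C)
    {C : T4PrintedShapeBanking.Consts} {O : PrintedO1s}
    {rr : ℕ} {β₀ : ℝ} (h : ThresholdOK C F.L rr β₀) (hμ : 0 < C.μ) (d n : ℕ)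
    (hκ₁ : (d : ℝ) * Real.log F.L + 2 * Real.log 2 ≤ C.κ₁) (hE₀ : Real.log (2 + birthMass C) ≤ C.E₀)
    (hA₀ : 1 ≤ C.A₀) (hβ₀ : 0 < β₀) (hLβ : (F.L : ℝ) * β₀ ≤ 1) (hn₁ : 13 ≤ C.n₁) (hn : 0 < n)
    {θ : ℝ} (hθ : 0 ≤ θ) (hslack : C.a + θ ≤ O.γ₀ * O.A₁ ^ 2 / 2)
    (hE₂ : 0 < C.E₂) (hE₃ : 0 ≤ C.E₃) {sS : ℕ} (hsS : 1 ≤ sS)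
    (hsmall : (((2 * cth 32 1 sS + 1) ^ d : ℕ) : ℝ) * (5 : ℝ) ^ d * ((max 1 (2 * 32 + 2) : ℕ) : ℝ) ≤
      (F.L : ℝ) ^ (sS / 2) / 2)
    {θc : ℝ} (hθc0 : 0 ≤ θc) (hθc1 : θc < 1) (hθcs : 1 / 2 ≤ θc ^ sS)
    (hθJ : (2 +
            ((2 * (((2 * cth 32 1 sS + 1) ^ d : ℕ) : ℝ) * ((((2 * 32 + 1) ^ d : ℕ) : ℝ) * (4 * 2 ^ d)) +
                  4 * ((((2 * cth 32 1 sS + 1) ^ d : ℕ) : ℝ) * (5 : ℝ) ^ d)) / (1 - θc) +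
              2 * (2 * ((((2 * cth 32 1 sS + 1) ^ d : ℕ) : ℝ) * (5 : ℝ) ^ d))) +
            (2 * ((0 + 2 * Real.log (2 * d + 1)) + (2 * (d : ℝ) + 2 * Real.log (2 * d + 1)) *
                  (((max 1 (2 * 32 + 2) : ℕ) : ℝ) * (2 * ((((2 * cth 32 1 sS + 1) ^ d : ℕ) : ℝ) * (5 : ℝ) ^ d)))) +
              (2 * (d : ℝ) + 2 * Real.log (2 * d + 1)) * 1 *
                (((max 1 (2 * 32 + 2) : ℕ) : ℝ) *
                    ((2 * (((2 * cth 32 1 sS + 1) ^ d : ℕ) : ℝ) * ((((2 * 32 + 1) ^ d : ℕ) : ℝ) * (4 * 2 ^ d)) +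
                        4 * ((((2 * cth 32 1 sS + 1) ^ d : ℕ) : ℝ) * (5 : ℝ) ^ d)) / (1 - θc)) +
                  4 * 2 ^ d)) +
            10) + 8 * 2 ^ d * Real.log (2 * d + 1) ≤ θ)
    (hData : T4ContinuumYM4Torus.ForSmallCouplings D fun g₀ => ∀ os : List (ULoop F),
        ∃ (ι α π : Type) (_ : DecidableEq ι) (_ : DecidableEq α) (_ : DecidableEq π),
          Nonempty (CountRoadWitnessT3b D C O rr d n hn g₀ os ι α π)) :
    D.ym4_torus_continuum_limit_exists :=
  T4ApexHybrid.limit_exists_of_hybridNE7Under D hM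
    (hybridNE7Under_of_countRoadT3b_fsc D hM hsign h hμ d n hκ₁ hE₀ hA₀ hβ₀ hLβ hn₁ hn hθ hslack hE₂ hE₃ hsS hsmall hθc0 hθc1 hθcs hθJ hData)

/-- **COROLLARY: UNIQUENESS** of the limit points (`D.ym4_torus_continuum_limit_unique`) under the same displayed data — by
`T4ApexHybrid.limit_unique_of_hybridNE7Under`.  CONDITIONAL; NE7b NOT proved. [folklore] -/
theorem limit_unique_of_countRoadT3b_fsc (D : FiniteEpsData F G) (hM : D.AvgMeasurable)
    (hsign : B16.SignConventions D.C)
    {C : T4PrintedShapeBanking.Consts} {O : PrintedO1s}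
    {rr : ℕ} {β₀ : ℝ} (h : ThresholdOK C F.L rr β₀) (hμ : 0 < C.μ) (d n : ℕ)
    (hκ₁ : (d : ℝ) * Real.log F.L + 2 * Real.log 2 ≤ C.κ₁) (hE₀ : Real.log (2 + birthMass C) ≤ C.E₀)
    (hA₀ : 1 ≤ C.A₀) (hβ₀ : 0 < β₀) (hLβ : (F.L : ℝ) * β₀ ≤ 1) (hn₁ : 13 ≤ C.n₁) (hn : 0 < n)
    {θ : ℝ} (hθ : 0 ≤ θ) (hslack : C.a + θ ≤ O.γ₀ * O.A₁ ^ 2 / 2)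
    (hE₂ : 0 < C.E₂) (hE₃ : 0 ≤ C.E₃) {sS : ℕ} (hsS : 1 ≤ sS)
    (hsmall : (((2 * cth 32 1 sS + 1) ^ d : ℕ) : ℝ) * (5 : ℝ) ^ d * ((max 1 (2 * 32 + 2) : ℕ) : ℝ) ≤
      (F.L : ℝ) ^ (sS / 2) / 2)
    {θc : ℝ} (hθc0 : 0 ≤ θc) (hθc1 : θc < 1) (hθcs : 1 / 2 ≤ θc ^ sS)
    (hθJ : (2 +
            ((2 * (((2 * cth 32 1 sS + 1) ^ d : ℕ) : ℝ) * ((((2 * 32 + 1) ^ d : ℕ) : ℝ) * (4 * 2 ^ d)) +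
                  4 * ((((2 * cth 32 1 sS + 1) ^ d : ℕ) : ℝ) * (5 : ℝ) ^ d)) / (1 - θc) +
              2 * (2 * ((((2 * cth 32 1 sS + 1) ^ d : ℕ) : ℝ) * (5 : ℝ) ^ d))) +
            (2 * ((0 + 2 * Real.log (2 * d + 1)) + (2 * (d : ℝ) + 2 * Real.log (2 * d + 1)) *
                  (((max 1 (2 * 32 + 2) : ℕ) : ℝ) * (2 * ((((2 * cth 32 1 sS + 1) ^ d : ℕ) : ℝ) * (5 : ℝ) ^ d)))) +
              (2 * (d : ℝ) + 2 * Real.log (2 * d + 1)) * 1 *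
                (((max 1 (2 * 32 + 2) : ℕ) : ℝ) *
                    ((2 * (((2 * cth 32 1 sS + 1) ^ d : ℕ) : ℝ) * ((((2 * 32 + 1) ^ d : ℕ) : ℝ) * (4 * 2 ^ d)) +
                        4 * ((((2 * cth 32 1 sS + 1) ^ d : ℕ) : ℝ) * (5 : ℝ) ^ d)) / (1 - θc)) +
                  4 * 2 ^ d)) +
            10) + 8 * 2 ^ d * Real.log (2 * d + 1) ≤ θ)
    (hData : T4ContinuumYM4Torus.ForSmallCouplings D fun g₀ => ∀ os : List (ULoop F),
        ∃ (ι α π : Type) (_ : DecidableEq ι) (_ : DecidableEq α) (_ : DecidableEq π),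
          Nonempty (CountRoadWitnessT3b D C O rr d n hn g₀ os ι α π)) :
    D.ym4_torus_continuum_limit_unique :=
  T4ApexHybrid.limit_unique_of_hybridNE7Under D hM
    (hybridNE7Under_of_countRoadT3b_fsc D hM hsign h hμ d n hκ₁ hE₀ hA₀ hβ₀ hLβ hn₁ hn hθ hslack hE₂ hE₃ hsS hsmall hθc0 hθc1 hθcs hθJ hData)

end Under

section SU

variable {F : T4Family} {N : ℕ} [NeZero N] {ℰ : LoopAverage (Matrix.specialUnitaryGroup (Fin N) ℂ)}

/-- **THE FOUR T⁴ TARGETS FROM THE COUNT ROAD OVER END v3′**, for (0.4)-block-averaged data on `SU(N)` with a measurable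
small-loop average: `hybridNE7Under_of_countRoadT3b_fsc` ∘ `T4ApexHybrid.targets_of_hybridNE7Under`.  CONDITIONAL on (B),
`BetaPertHyp` (inside the targets' own prefix) and the displayed prefixed witnesses; NE7b NOT proved. [folklore] -/
theorem targets_of_countRoadT3b_fsc (D : FiniteEpsData F (Matrix.specialUnitaryGroup (Fin N) ℂ))
    (hBA : D.IsBlockAveraged ℰ) (hE : ℰ.MeasurableE) (hsign : B16.SignConventions D.C)
    {C : T4PrintedShapeBanking.Consts} {O : PrintedO1s}
    {rr : ℕ} {β₀ : ℝ} (h : ThresholdOK C F.L rr β₀) (hμ : 0 < C.μ) (d n : ℕ)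
    (hκ₁ : (d : ℝ) * Real.log F.L + 2 * Real.log 2 ≤ C.κ₁) (hE₀ : Real.log (2 + birthMass C) ≤ C.E₀)
    (hA₀ : 1 ≤ C.A₀) (hβ₀ : 0 < β₀) (hLβ : (F.L : ℝ) * β₀ ≤ 1) (hn₁ : 13 ≤ C.n₁) (hn : 0 < n)
    {θ : ℝ} (hθ : 0 ≤ θ) (hslack : C.a + θ ≤ O.γ₀ * O.A₁ ^ 2 / 2)
    (hE₂ : 0 < C.E₂) (hE₃ : 0 ≤ C.E₃) {sS : ℕ} (hsS : 1 ≤ sS)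
    (hsmall : (((2 * cth 32 1 sS + 1) ^ d : ℕ) : ℝ) * (5 : ℝ) ^ d * ((max 1 (2 * 32 + 2) : ℕ) : ℝ) ≤
      (F.L : ℝ) ^ (sS / 2) / 2)
    {θc : ℝ} (hθc0 : 0 ≤ θc) (hθc1 : θc < 1) (hθcs : 1 / 2 ≤ θc ^ sS)
    (hθJ : (2 +
            ((2 * (((2 * cth 32 1 sS + 1) ^ d : ℕ) : ℝ) * ((((2 * 32 + 1) ^ d : ℕ) : ℝ) * (4 * 2 ^ d)) +
                  4 * ((((2 * cth 32 1 sS + 1) ^ d : ℕ) : ℝ) * (5 : ℝ) ^ d)) / (1 - θc) +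
              2 * (2 * ((((2 * cth 32 1 sS + 1) ^ d : ℕ) : ℝ) * (5 : ℝ) ^ d))) +
            (2 * ((0 + 2 * Real.log (2 * d + 1)) + (2 * (d : ℝ) + 2 * Real.log (2 * d + 1)) *
                  (((max 1 (2 * 32 + 2) : ℕ) : ℝ) * (2 * ((((2 * cth 32 1 sS + 1) ^ d : ℕ) : ℝ) * (5 : ℝ) ^ d)))) +
              (2 * (d : ℝ) + 2 * Real.log (2 * d + 1)) * 1 *
                (((max 1 (2 * 32 + 2) : ℕ) : ℝ) *
                    ((2 * (((2 * cth 32 1 sS + 1) ^ d : ℕ) : ℝ) * ((((2 * 32 + 1) ^ d : ℕ) : ℝ) * (4 * 2 ^ d)) +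
                        4 * ((((2 * cth 32 1 sS + 1) ^ d : ℕ) : ℝ) * (5 : ℝ) ^ d)) / (1 - θc)) +
                  4 * 2 ^ d)) +
            10) + 8 * 2 ^ d * Real.log (2 * d + 1) ≤ θ)
    (hData : T4ContinuumYM4Torus.ForSmallCouplings D fun g₀ => ∀ os : List (ULoop F),
        ∃ (ι α π : Type) (_ : DecidableEq ι) (_ : DecidableEq α) (_ : DecidableEq π),
          Nonempty (CountRoadWitnessT3b D C O rr d n hn g₀ os ι α π)) :
    D.ym4_torus_continuum_limit_exists ∧ D.ym4_torus_continuum_limit_unique ∧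
      D.limit_reflectionPositive ∧ D.limit_torusCovariant :=
  T4ApexHybrid.targets_of_hybridNE7Under hBA hE
    (hybridNE7Under_of_countRoadT3b_fsc D (hBA.avgMeasurable hE) hsign h hμ d n hκ₁ hE₀ hA₀ hβ₀ hLβ hn₁ hn hθ hslack hE₂ hE₃ hsS hsmall hθc0 hθc1 hθcs hθJ hData)

/-- **THE HEADLINE PREDICATE FROM THE COUNT ROAD OVER END v3′**: `T4ContinuumYM4Torus.ContinuumYM4Torus D` for
(0.4)-block-averaged data on `SU(N)` with a measurable small-loop average, GIVEN the two pins
`(B) = B16.EndStatementBPrinted D.C` and `BetaPertHyp D.βfun` BY NAME, the datum's sign conventions, END v3′'s constants-only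
side conditions, and a `CountRoadWitnessT3b` for all small-coupling tuned runs and every loop string
(`targets_of_countRoadT3b_fsc` ∘ `T4ContinuumYM4Torus.continuumYM4Torus_of_targets`).  Honest reading in the module
docstring: the located new estimates are INSIDE the witness; nothing of them is discharged; the multiplicity is no longer
displayed; NE7b NOT proved; count 0∕9. [folklore] -/
theorem continuumYM4Torus_of_countRoadT3b_fsc (D : FiniteEpsData F (Matrix.specialUnitaryGroup (Fin N) ℂ))
    (hBA : D.IsBlockAveraged ℰ) (hE : ℰ.MeasurableE)
    (hB : B16.EndStatementBPrinted D.C) (hβ : BetaPertHyp D.βfun) (hsign : B16.SignConventions D.C)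
    {C : T4PrintedShapeBanking.Consts} {O : PrintedO1s}
    {rr : ℕ} {β₀ : ℝ} (h : ThresholdOK C F.L rr β₀) (hμ : 0 < C.μ) (d n : ℕ)
    (hκ₁ : (d : ℝ) * Real.log F.L + 2 * Real.log 2 ≤ C.κ₁) (hE₀ : Real.log (2 + birthMass C) ≤ C.E₀)
    (hA₀ : 1 ≤ C.A₀) (hβ₀ : 0 < β₀) (hLβ : (F.L : ℝ) * β₀ ≤ 1) (hn₁ : 13 ≤ C.n₁) (hn : 0 < n)
    {θ : ℝ} (hθ : 0 ≤ θ) (hslack : C.a + θ ≤ O.γ₀ * O.A₁ ^ 2 / 2)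
    (hE₂ : 0 < C.E₂) (hE₃ : 0 ≤ C.E₃) {sS : ℕ} (hsS : 1 ≤ sS)
    (hsmall : (((2 * cth 32 1 sS + 1) ^ d : ℕ) : ℝ) * (5 : ℝ) ^ d * ((max 1 (2 * 32 + 2) : ℕ) : ℝ) ≤
      (F.L : ℝ) ^ (sS / 2) / 2)
    {θc : ℝ} (hθc0 : 0 ≤ θc) (hθc1 : θc < 1) (hθcs : 1 / 2 ≤ θc ^ sS)
    (hθJ : (2 +
            ((2 * (((2 * cth 32 1 sS + 1) ^ d : ℕ) : ℝ) * ((((2 * 32 + 1) ^ d : ℕ) : ℝ) * (4 * 2 ^ d)) +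
                  4 * ((((2 * cth 32 1 sS + 1) ^ d : ℕ) : ℝ) * (5 : ℝ) ^ d)) / (1 - θc) +
              2 * (2 * ((((2 * cth 32 1 sS + 1) ^ d : ℕ) : ℝ) * (5 : ℝ) ^ d))) +
            (2 * ((0 + 2 * Real.log (2 * d + 1)) + (2 * (d : ℝ) + 2 * Real.log (2 * d + 1)) *
                  (((max 1 (2 * 32 + 2) : ℕ) : ℝ) * (2 * ((((2 * cth 32 1 sS + 1) ^ d : ℕ) : ℝ) * (5 : ℝ) ^ d)))) +
              (2 * (d : ℝ) + 2 * Real.log (2 * d + 1)) * 1 *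
                (((max 1 (2 * 32 + 2) : ℕ) : ℝ) *
                    ((2 * (((2 * cth 32 1 sS + 1) ^ d : ℕ) : ℝ) * ((((2 * 32 + 1) ^ d : ℕ) : ℝ) * (4 * 2 ^ d)) +
                        4 * ((((2 * cth 32 1 sS + 1) ^ d : ℕ) : ℝ) * (5 : ℝ) ^ d)) / (1 - θc)) +
                  4 * 2 ^ d)) +
            10) + 8 * 2 ^ d * Real.log (2 * d + 1) ≤ θ)
    (hData : T4ContinuumYM4Torus.ForSmallCouplings D fun g₀ => ∀ os : List (ULoop F),
        ∃ (ι α π : Type) (_ : DecidableEq ι) (_ : DecidableEq α) (_ : DecidableEq π),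
          Nonempty (CountRoadWitnessT3b D C O rr d n hn g₀ os ι α π)) :
    T4ContinuumYM4Torus.ContinuumYM4Torus D :=
  T4ContinuumYM4Torus.continuumYM4Torus_of_targets hB hβ
    (targets_of_countRoadT3b_fsc D hBA hE hsign h hμ d n hκ₁ hE₀ hA₀ hβ₀ hLβ hn₁ hn hθ hslack hE₂ hE₃ hsS hsmall hθc0 hθc1 hθcs hθJ hData)

end SU

end

end Summit.QuantumFields.BalabanUV.T4Continuum.HistoryRealiseCellsRunHeadlineT3b
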